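import Summits.BirchSwinnertonDyer.BirchSwinnertonDyer.Theorems.ByReductionTypeAtTwoSupersingularColemanClassKit
import Summits.BirchSwinnertonDyer.BirchSwinnertonDyer.Theorems.ByReductionTypeAtTwoSupersingularColemanInstance16173a
import HarnessLib

/-!
# Crux `SupersingularRankZeroAtTwo` (item stmt-BirchSwinnertonDyer-19097, route ByReductionTypeAtTwo, rung K4):
# CLASS INSTANCE on the Coleman road v5 — the class **16173a** (member `16173a1 = [0, 0, 1, -1231140, -525745062]`),
# the v5 twin of GEN 7's `bsdp_two_16173a1_of_colemanKato` (v4 door, `…ColemanInstance16173a.lean`, p484590)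

HONEST FRAMING (cell `bsd-2adic`, HUMAN RULINGS D-0036/D-0054/D-0074): a CLASS INSTANCE, not a booking;
THEOREMS ONLY; BSD is NOT proved by any of this. PARTITION (D-0054): X5@2 good-supersingular, `a₂ = 0`
sub-row × `p = 2` — types-the-object-of (item 19097 AT the class `16173a`, v5 binder set); closes none.
The kernel-decided data of `16173a1` (`Δ`, `c₄`, minimality, `#Ẽ(𝔽₂) = 3`, no CM, the DD certificates
`ℓ = 11, 5, 4, 23`) are GEN 7's theorems of `…ColemanInstance16173a.lean`; this file only adds `b₂, b₄, b₆`
over `ℤ` and the instance in the v5 binder set {`hmod`, `hGZK`, `h124`, `hX0`, `hDD`} + {`h12`, `hKim`,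
`hCK` v5} + CERT {`L(E,1) ≠ 0`, `#Ш_an = 16`, `2⁴ ∣ #Ш`}, through the kit's
`bsdp_two_baseChange_int_of_colemanKatoV5` — so that all 206 surjective `a₂ = 0` classes carry the SAME
(v5) binder set. References: [CremonaAlgorithms1997] Table 1 (16173a1); [Kobayashi2003] Thm. 1.2, 4.1, §7;
[Kato2004Asterisque] Thm. 12.4–12.6; [BDKim2013] Cor. 3.15; [KuriharaOtsuki2006] p. 564;
[DokchitserDokchitserMathZ2012] Theorem; [Miller2011LMS] Def. 1.1.
-/

set_option autoImplicit false
-- the Theorems namespace of this sub repeats the summit name by design (D-0017 nested layout)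
set_option linter.dupNamespace false

noncomputable section

open scoped Classical MatrixGroups ModularForm
open CongruenceSubgroup WeierstrassCurve Literature.NumberTheory.EllipticCurves
  Literature.NumberTheory.EllipticCurves.ModularForms Literature.NumberTheory.EllipticCurves.Sprung2017
  Literature.NumberTheory.EllipticCurves.Rank1Residual Literature.NumberTheory.EllipticCurves.Rank1Residual.Typed
  Literature.NumberTheory.EllipticCurves.Kobayashi2003 Literature.NumberTheory.EllipticCurves.IwasawaDual
  ZpExtension Summit.BirchSwinnertonDyer.Rank1Residual Summit.BirchSwinnertonDyer.Rank1Residual.Supersingular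
  Summit.BirchSwinnertonDyer.Rank1Residual.X5 Summit.BirchSwinnertonDyer.Rank1Residual.X5.O1
  Summit.BirchSwinnertonDyer.Rank1Residual.X5.Instances

namespace Summit.BirchSwinnertonDyer.BirchSwinnertonDyer.Theorems
namespace SSColemanRoad

/-- `b₂, b₄, b₆` of `16173a1` over `ℤ`. [cite: SilvermanAEC2009, III.1] -/
theorem M16173a1_b :
    (⟨0, 0, 1, -1231140, -525745062⟩ : WeierstrassCurve ℤ).b₂ = 0 ∧
      (⟨0, 0, 1, -1231140, -525745062⟩ : WeierstrassCurve ℤ).b₄ = -2462280 ∧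
      (⟨0, 0, 1, -1231140, -525745062⟩ : WeierstrassCurve ℤ).b₆ = -2102980247 := by
  decide

/-! ## §2 `BSD(16173a1, 2)` on the Coleman road v5 -/

/-- **`BSD(16173a1, 2) ∧ KobayashiMainConjecture(16173a1, 2, +)` ON THE COLEMAN ROAD v5** — class instance of
crux `SupersingularRankZeroAtTwo` at the class `16173a`. Displayed: PRINT {`hmod`, `hGZK`, `h124`, `hX0`,
`hDD`}; READ-AT-2 {`h12`, `hKim`, `hCK` (v5 package: F1 (7.21)@2 · F3a · F3b `2^m` · F4rat · guarded clause)};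
CERT {`L(E,1) ≠ 0`, `#Ш_an = 16`, `2^4 ∣ #Ш`}. KERNEL: `Δ`, `c₄`, `b`'s, `2 ∤ Δ`, `#Ẽ(𝔽₂) = 3`,
`j = c₄³/Δ = 849258229762523136000/77114156402999`, DD certificates `ℓ = 11, 5, 4, 23`, `2^5 ∤ 16`. Closes nothing by itself.
[cite: Kobayashi2003, Thm. 1.2, Thm. 4.1 and §7] [cite: Kato2004Asterisque, Thm. 12.4–12.6]
[cite: BDKim2013, Cor. 3.15] [cite: KuriharaOtsuki2006, p. 564] [cite: DokchitserDokchitserMathZ2012, Theorem]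
[cite: CremonaAlgorithms1997, Table 1] [cite: Miller2011LMS, Def. 1.1] -/
theorem bsdp_two_16173a1_of_colemanKatoV5
    (hmod : nonempty_modularParametrizationData)
    (hGZK : rank_eq_analyticRank_of_analyticRank_le_one)
    (h124 : Kato2004.thm12_4) (hX0 : Kato2004_fineSelmerDual_isTorsion)
    (hDD : DokchitserDokchitser2012_surjective_mod_two_four_eight) :
    ∀ (W : WeierstrassCurve ℚ) [W.IsElliptic] [W.IsGloballyMinimal],
      W = (⟨0, 0, 1, -1231140, -525745062⟩ : WeierstrassCurve ℤ).baseChange ℚ →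
    (∀ (κ : ZpExtension ℚ 2) (γ : Field.absoluteGaloisGroup ℚ),
      κ.IsCyclotomic → κ.IsTopGenerator γ →
      ∀ D : SignedSelmerDualData W κ γ 1,
        Module.Finite (IwasawaAlgebra 2) D.X ∧ Module.IsTorsion (IwasawaAlgebra 2) D.X) →
    (∀ (κ : ZpExtension ℚ 2) (γ : Field.absoluteGaloisGroup ℚ),
      κ.IsCyclotomic → κ.IsTopGenerator γ →
      ∀ (D : SignedSelmerDualData W κ γ 1) [Module.Finite (IwasawaAlgebra 2) D.X],
        Module.IsTorsion (IwasawaAlgebra 2) D.X →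
      ∀ g : IwasawaAlgebra 2, D.charIdeal = Ideal.span {g} → Finite (W.selmerGroupPInfty 2) →
        ∃ u : ℤ_[2]ˣ, ((PowerSeries.constantCoeff g : ℤ_[2]) : ℚ_[2]) =
          ((u : ℤ_[2]) : ℚ_[2]) * ((2 : ℕ) : ℚ_[2]) ^ (padicValNat 2 W.tamagawaProduct) *
            (Nat.card (W.selmerGroupPInfty 2) : ℚ_[2])) →
    (∀ (κ : ZpExtension ℚ 2) (γ : Field.absoluteGaloisGroup ℚ),
      κ.IsCyclotomic → κ.IsTopGenerator γ → IsCyclotomicVariable 2 γ →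
      ∀ [NeZero (W.conductorNorm ℤ)] (f : CuspForm (Gamma0 (W.conductorNorm ℤ)) 2),
        IsNewformOf W f → ∀ (ϖ : ℚ), (ϖ : ℝ) * W.realPeriodRat = plusPeriod f →
      ∀ (Lplus Lminus : IwasawaAlgebra 2), IsPollackPair f 2 Lplus Lminus →
      ∀ (D : SignedSelmerDualData W κ γ 1) [ContinuousSMul ℤ_[2] (W.tateModule 2)],
        ∃ (I : Kato2004.IwasawaH1Data W 2 κ γ) (Y : W.FineSelmerDualData κ γ)
          (P : Submodule (IwasawaAlgebra 2) (IwasawaAlgebra 2))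
          (loc : I.H →ₗ[IwasawaAlgebra 2] P) (toX : P →ₗ[IwasawaAlgebra 2] D.X)
          (δ : D.X →ₗ[IwasawaAlgebra 2] Y.X) (Z : Submodule (IwasawaAlgebra 2) I.H)
          (G : IwasawaAlgebra 2) (m : ℕ),
          Function.Exact loc toX ∧ Function.Exact toX δ ∧
          G ∈ Submodule.map (P.subtype ∘ₗ loc) Z ∧
          iwasawaToPowerSeries 2 G =
            PowerSeries.C ((2 : ℚ_[2]) ^ m * (ϖ : ℚ_[2])) *
              iwasawaToPowerSeries 2 (kobayashiL 1 Lplus Lminus) ∧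
          (∀ 𝔭 : PrimeSpectrum (IwasawaAlgebra 2), 𝔭.asIdeal.height = 1 →
            PowerSeries.C (2 : ℤ_[2]) ∉ 𝔭.asIdeal →
            Literature.NumberTheory.EllipticCurves.Module.lengthAt (IwasawaAlgebra 2) Y.X 𝔭 ≤
              Literature.NumberTheory.EllipticCurves.Module.lengthAt (IwasawaAlgebra 2) (I.H ⧸ Z) 𝔭) ∧
          (TwoAdicSurjective W → m = 0 ∧
            ∀ 𝔭 : PrimeSpectrum (IwasawaAlgebra 2), 𝔭.asIdeal.height = 1 →
              PowerSeries.C (2 : ℤ_[2]) ∈ 𝔭.asIdeal →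
              Literature.NumberTheory.EllipticCurves.Module.lengthAt (IwasawaAlgebra 2) Y.X 𝔭 ≤
                Literature.NumberTheory.EllipticCurves.Module.lengthAt (IwasawaAlgebra 2) (I.H ⧸ Z) 𝔭)) →
    W.entireLFunction 1 ≠ 0 → shaAn W = ((16 : ℕ) : ℚ) → 2 ^ 4 ∣ W.shaOrder →
      BSDp W 2 ∧ KobayashiMainConjecture W 2 1 :=
  bsdp_two_baseChange_int_of_colemanKatoV5 _ M16173a1_b.1 M16173a1_b.2.1 M16173a1_b.2.2 M16173a1_Δ M16173a1_c₄
    (by decide) card_F2_16173a1 (n := 849258229762523136000) (d := 77114156402999) (by decide) (by norm_num)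
    (ℓ₁ := 11) (ℓ₂ := 5) (ℓ₃ := 4) (ℓ₄ := 23) (by norm_num)
    (by decide) (by decide) (by decide) (by decide) (Q := 16) (m := 4) (by decide) (by decide)
    hmod hGZK h124 hX0 hDD

end SSColemanRoad
end Summit.BirchSwinnertonDyer.BirchSwinnertonDyer.Theorems

end
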